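import Summits.CriticalPhenomena.SAWScalingLimit.Theorems.SAWLoopFugacityFlowSimpleSubseqLimitsTwoStrandExponent
import HarnessLib

/-!
# The STOPPING-TIME-FREE exponent interface of the ORDER input: near-double-point sub-area bounds
(crux stmt-CriticalPhenomena-4982, decl
`Summit.CriticalPhenomena.SAWScalingLimit.Theses.SAWLoopFugacityFlow.SimpleSubseqLimits`; line
`past-shadowing-costs-halves` v4; line lead c5, 2026-08-17)

`FarPast.Exponent` (file `…SimpleSubseqLimitsTwoStrandExponent.lean`) converts a sub-area one-point bound on
LOCALISED FIRST-ENTRANCE past/future returns into the crux's residual `PastFutureAvoidance`. The event there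
still carries the first-entrance stopping time and the guard ball of the residual. This file removes
both: the textbook one-point configuration "`z` is a `(ρ, R)`-near double point" — two visits to `B(z, ρ)`
separated by an excursion to distance `≥ R` from `z` — suffices, because a localised first-entrance return
with entrance radius `2r` is a `(ρ, r)`-near double point (`nearDoublePoint_of_local`).

* `NearDoublePoint γ z ρ R`, `NearDoublePointBoundAt D a b` (`P_δ ≤ θ ρ²` for `ρ < ρ₀(R, θ)`, every
  centre `z`, eventually in `δ` — the near-double-point exponent exceeds `2`; SLE_{8/3} value `35/12`),
  `NearDoublePointBound` (along every endpoint approximation);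
* `nearDoublePointBoundAt_of_powerBound` (any `C ρ^{2+c}` bound, `c > 0`, gives it),
  `localReturnDecayAt_of_nearDoublePointBoundAt`, `pastFutureAvoidance_of_nearDoublePointBound`
  (= registered `stub_nearDoublePointInterface`), and the corollaries to the crux (with the A-side crux /
  with `BoundaryDecay`) and to `SAWScalingLimit` (with `AvoidanceLimit + EventualTight`).

Like `LocalReturnDecay`, this input is STRONGER than the residual and not implied by the summit conjecture;
it is recorded as the interface through which a quantitative lattice result would close the crux.
-/

noncomputable section

open MeasureTheory Filter Topology Set Metric Function
open Literature.Probability.RandomPlanarGeometry Literature.Probability.RandomPlanarGeometry.SAW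
open Literature.Probability.LatticeModels
open scoped ENNReal NNReal BoundedContinuousFunction unitInterval

namespace Summit.CriticalPhenomena.SAWScalingLimit.Theorems.SimpleSubseqLimits.FarPast.Exponent

open Summit.CriticalPhenomena.SAWScalingLimit.Theses.SAWLoopFugacityFlow
  (SimpleSubseqLimits AvoidanceLimit EventualTight)
open Summit.CriticalPhenomena.SAWScalingLimit.Theorems.SimpleSubseqLimits.MarkedPointRevisit.Passage
  (latticeCurve)
open Summit.CriticalPhenomena.SAWScalingLimit.Theorems.SimpleSubseqLimits.Boundary.Passage (BoundaryDecay)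
open Summit.CriticalPhenomena.SAWScalingLimit.Theorems.SimpleSubseqLimits.FarPast.Line
  (PastFutureAvoidance simpleSubseqLimits_of_pastFutureAvoidance)
open Summit.CriticalPhenomena.SAWScalingLimit.Theorems.SimpleSubseqLimits.FarPast.RouteResidual
  (line_pastFuture_avoidanceLimit sawScalingLimit_of_three_inputs)

variable {D : DobrushinDomain} {a b : ℝ → Site 2}

/-! ## Near double points and their sub-area bound -/

/-- **Near double point at `z`** (the textbook one-point configuration, no stopping time, no guard ball
around a marked centre): two visits to `B(z, ρ)` at times `v < t'` separated by an excursion to distance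
`≥ R` from `z` at some intermediate time `τ`. -/
def NearDoublePoint (γ : Curve ℂ) (z : ℂ) (ρ R : ℝ) : Prop :=
  ∃ v τ t' : I, v < τ ∧ τ ≤ t' ∧ dist (γ v) z < ρ ∧ dist (γ t') z < ρ ∧ R ≤ dist (γ τ) z

/-- **Sub-area bound on near double points at `(D; a_δ, b_δ)`**: for every excursion size `R > 0` and
`θ > 0` there is `ρ₀ > 0` such that for all `ρ ∈ (0, ρ₀)` and every centre `z`, eventually as
`δ → 0⁺`, `P_δ[NearDoublePoint … z ρ R] ≤ θ ρ²` — "the probability that `z` is a `(ρ, R)`-near-double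
point of the critical SAW is `o(ρ²)`, uniformly in `z`" (near-double-point exponent `> 2`; SLE_{8/3}
value `35/12`). An open lattice statement STRONGER than `LocalReturnDecayAt` (and than the crux's
residual); untagged. -/
def NearDoublePointBoundAt (D : DobrushinDomain) (a b : ℝ → Site 2) : Prop :=
  ∀ R θ : ℝ, 0 < R → 0 < θ → ∃ ρ₀ : ℝ, 0 < ρ₀ ∧ ∀ ρ : ℝ, 0 < ρ → ρ < ρ₀ → ∀ z : ℂ,
    ∀ᶠ δ in 𝓝[>] (0 : ℝ),
      SAW.law D.carrier δ (a δ) (b δ) {γ | NearDoublePoint (latticeCurve γ) z ρ R} ≤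
        ENNReal.ofReal (θ * ρ ^ 2)

/-- Sub-area bound on near double points along every endpoint approximation (open, untagged). -/
def NearDoublePointBound : Prop :=
  ∀ (D : DobrushinDomain) (a b : ℝ → Site 2), SAW.IsEndpointApprox D a b → NearDoublePointBoundAt D a b

/-- **A localised first-entrance past/future return with entrance radius `2r` is a near double point
with excursion size `r`** (for `ρ ≤ r`): the entrance value `γ τ ∈ B̄(q, 2r)` is `> 3r`-far from the
far-past value `γ v` (outside `B̄(q, 5r)`), hence `≥ 3r - ρ ≥ r`-far from the centre `z ∋ B(z, ρ) ∋ γ v`.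
[folklore] -/
theorem nearDoublePoint_of_local {γ : Curve ℂ} {q z : ℂ} {r ρ : ℝ} (hρr : ρ ≤ r)
    (h : LocalPastFutureReturn γ q r (2 * r) z ρ) : NearDoublePoint γ z ρ r := by
  obtain ⟨v, τ, t', hvτ, hτt, hτ, -, hguard, hv, ht'⟩ := h
  refine ⟨v, τ, t', hvτ, hτt, hv, ht', ?_⟩
  rw [mem_closedBall] at hτ
  have h1 : 5 * r < dist (γ v) q := hguard v le_rfl
  -- dist (γ v) q ≤ dist (γ v) z + dist z (γ τ) + dist (γ τ) q
  have h2 : dist (γ v) q ≤ dist (γ v) z + dist (γ τ) z + dist (γ τ) q := by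
    calc dist (γ v) q ≤ dist (γ v) (γ τ) + dist (γ τ) q := dist_triangle _ _ _
      _ ≤ (dist (γ v) z + dist z (γ τ)) + dist (γ τ) q := by gcongr; exact dist_triangle _ _ _
      _ = dist (γ v) z + dist (γ τ) z + dist (γ τ) q := by rw [dist_comm z]
  have h3 : 0 ≤ dist (γ v) z := dist_nonneg
  linarith

/-- **Any uniform power bound on near double points with exponent `> 2` gives the sub-area bound**: if
for every `R > 0` some `c > 0`, `C ≥ 0`, `ρ₁ > 0` satisfy `P_δ[NearDoublePoint … z ρ R] ≤ C ρ^{2+c}` for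
all `ρ ∈ (0, ρ₁)`, all `z`, eventually in `δ`, then `NearDoublePointBoundAt D a b`. [folklore] -/
theorem nearDoublePointBoundAt_of_powerBound
    (h : ∀ R : ℝ, 0 < R → ∃ c C ρ₁ : ℝ, 0 < c ∧ 0 ≤ C ∧ 0 < ρ₁ ∧
      ∀ ρ : ℝ, 0 < ρ → ρ < ρ₁ → ∀ z : ℂ, ∀ᶠ δ in 𝓝[>] (0 : ℝ),
        SAW.law D.carrier δ (a δ) (b δ) {γ | NearDoublePoint (latticeCurve γ) z ρ R} ≤
          ENNReal.ofReal (C * ρ ^ (2 + c))) :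
    NearDoublePointBoundAt D a b := by
  intro R θ hR hθ
  obtain ⟨c, C, ρ₁, hc, hC, hρ₁, hb⟩ := h R hR
  have htend : Tendsto (fun ρ : ℝ => C * ρ ^ c) (𝓝[>] (0 : ℝ)) (𝓝 0) := by
    have h0 : Tendsto (fun ρ : ℝ => ρ ^ c) (𝓝[>] (0 : ℝ)) (𝓝 0) := by
      have := (Real.continuousAt_rpow_const 0 c (Or.inr hc.le)).tendsto
      rw [Real.zero_rpow hc.ne'] at this
      exact this.mono_left nhdsWithin_le_nhds
    simpa using h0.const_mul C
  have hevt : ∀ᶠ ρ in 𝓝[>] (0 : ℝ), C * ρ ^ c < θ := htend (Iio_mem_nhds hθ)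
  have hevρ₁ : ∀ᶠ ρ in 𝓝[>] (0 : ℝ), ρ < ρ₁ := by
    filter_upwards [Ioo_mem_nhdsGT hρ₁] with ρ hρ using hρ.2
  obtain ⟨ρ₀, hρ₀, hρ₀p⟩ := (nhdsGT_basis (0 : ℝ)).eventually_iff.1 (hevt.and hevρ₁)
  refine ⟨ρ₀, hρ₀, fun ρ hρ hρlt z => ?_⟩
  obtain ⟨hθρ, hρ₁ρ⟩ := hρ₀p ⟨hρ, hρlt⟩
  filter_upwards [hb ρ hρ hρ₁ρ z] with δ hδ
  refine hδ.trans (ENNReal.ofReal_le_ofReal ?_)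
  have : C * ρ ^ (2 + c) = C * ρ ^ c * ρ ^ 2 := by
    rw [Real.rpow_add hρ, Real.rpow_two]; ring
  rw [this]
  exact mul_le_mul_of_nonneg_right hθρ.le (sq_nonneg _)

/-- **Near-double-point sub-area bounds give the sub-area decay of localised returns** (entrance radius
`r' = 2r`; `ρ₀` capped by `r`). [folklore] -/
theorem localReturnDecayAt_of_nearDoublePointBoundAt (h : NearDoublePointBoundAt D a b) :
    LocalReturnDecayAt D a b := by
  intro q r hr
  refine ⟨2 * r, by linarith, by linarith, fun θ hθ => ?_⟩
  obtain ⟨ρ₀, hρ₀, hb⟩ := h r θ hr hθ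
  refine ⟨min ρ₀ r, lt_min hρ₀ hr, fun ρ hρ hρlt z => ?_⟩
  have hρ₀' : ρ < ρ₀ := hρlt.trans_le (min_le_left _ _)
  have hρr : ρ ≤ r := (hρlt.trans_le (min_le_right _ _)).le
  filter_upwards [hb ρ hρ hρ₀' z] with δ hδ
  exact le_trans (measure_mono fun γ hγ => nearDoublePoint_of_local hρr hγ) hδ

/-- **Near-double-point sub-area bounds ⇒ first-entrance slit avoidance** (the residual of the crux).
[folklore] -/
theorem pastFutureAvoidance_of_nearDoublePointBound (h : NearDoublePointBound) : PastFutureAvoidance :=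
  pastFutureAvoidance_of_localReturnDecay fun D a b hab =>
    localReturnDecayAt_of_nearDoublePointBoundAt (h D a b hab)

/-- The crux from near-double-point sub-area bounds and the A-side crux (inside the routes).
[folklore] -/
theorem simpleSubseqLimits_of_nearDoublePointBound_avoidanceLimit (h : NearDoublePointBound)
    (hA : AvoidanceLimit) : SimpleSubseqLimits :=
  line_pastFuture_avoidanceLimit (pastFutureAvoidance_of_nearDoublePointBound h) hA

/-- The crux from near-double-point sub-area bounds and the BOUNDARY input (A-side-free). [folklore] -/
theorem simpleSubseqLimits_of_nearDoublePointBound (h : NearDoublePointBound) (hB : BoundaryDecay) :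
    SimpleSubseqLimits :=
  simpleSubseqLimits_of_pastFutureAvoidance (pastFutureAvoidance_of_nearDoublePointBound h) hB

/-- The summit conjunct from near-double-point sub-area bounds, the A-side crux and tightness.
[folklore] -/
theorem sawScalingLimit_of_nearDoublePointBound (hA : AvoidanceLimit) (h : NearDoublePointBound)
    (hT : EventualTight) : _root_.SAWScalingLimit :=
  sawScalingLimit_of_three_inputs hA (pastFutureAvoidance_of_nearDoublePointBound h) hT

/-- **Registered form (stub `stub_nearDoublePointInterface` of the crux item stmt-CriticalPhenomena-4982).**
The stopping-time-free exponent interface: a sub-area one-point bound on near double points of the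
critical SAW (`P_δ[z is a (ρ, R)-near-double point] ≤ θ ρ²` for small `ρ`, uniformly in `z`, eventually
in `δ`) implies first-entrance slit avoidance, the residual of the crux. [folklore] -/
theorem stub_nearDoublePointInterface : NearDoublePointBound → PastFutureAvoidance :=
  pastFutureAvoidance_of_nearDoublePointBound

end Summit.CriticalPhenomena.SAWScalingLimit.Theorems.SimpleSubseqLimits.FarPast.Exponent

end
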